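import Mathlib
import HarnessLib
import Summits.AnomalousDissipation.Statement
import Literature.Analysis.FluidPDE.PassiveScalarForced
import Literature.Analysis.FluidPDE.PassiveScalar

/-!
# Sketch — crux-ideate stmt-AnomalousDissipation-0211 (TwohalfdNeg), ideator 1, round 1

First lemmas of the two idea cards (they need not be proved here; they must elaborate).

* Card `replica-log-cost-enstrophy-threshold`:
  `LogSplittingCost` (finite-window, Eulerian form of the two-replica / Crippa–De Lellis
  log-cost inequality for a steadily sourced scalar) and the conditional 2-D core
  `ScalarNoAnomalyBelowLogSqEnstrophy` it implies after long-time averaging.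
* Support P1 of the same card (the "frozen enstrophy" input of its K1b; a second card
  `frozen-enstrophy-dichotomy` was drafted and NOT filed):
  `SourcedScalarNearInvariance` (the free evolution over a window of length `T` dissipates at
  most `4·(sourced dissipation over the window) + 4 T² sup q²` of the squared norm of the CURRENT
  field — applied to the planar vorticity, whose source is `curl g` and whose dissipation is the
  ν-uniformly bounded enstrophy throughput).
-/

namespace Summit.AnomalousDissipation.AnomalousDissipation.Cruxes.TwohalfdNeg.Ideator1

open MeasureTheory Filter Set
open Literature.Analysis.FunctionSpaces
open Literature.Analysis.FluidPDE
open Literature.Analysis.FluidPDE.Torus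

local notation "𝕋²" => UnitAddTorus (Fin 2)
local notation "E²" => EuclideanSpace ℝ (Fin 2)

/-- **First lemma of card `replica-log-cost-enstrophy-threshold` (finite window, Eulerian
statement; proof Lagrangian).** For a smooth steady source `h` on `T²` there is `C = C(h)` such
that for every diffusivity `0 < κ ≤ 1/2`, every smooth divergence-free velocity `u` and every
classical solution `θ` of `∂ₜθ + u·∇θ = κΔθ + h` on `(0,∞) × T²`, every window `[t₀, t₀+T]`, `t₀ > 0`, and every
separation scale `ℓ > 0`:
`κ∫_{t₀}^{t₀+T}‖∇θ‖² ≤ C·( ‖θ(t₀)‖² + ℓ²T² + T²·(∫_{t₀}^{t₀+T}‖∇u(s)‖_{L²}ds + T + 1)/log(1+ℓ²/κ) )`.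
Proof sketch: two-replica Feynman–Kac identity `κ∫‖∇θ‖² = ¼∫E|A¹-A²|²` (Drivas–Eyink), the old
field contributes `≤ C‖θ(t₀)‖²`, non-split pairs contribute `≤ ‖∇h‖∞² ℓ²T²`, and the measure of
pairs split to distance `ℓ` by time `T` is `≤ (C'∫‖∇u‖_{L²} + C''(T+1))/(½log(1+ℓ²/κ))` by the
Crippa–De Lellis functional `½log(1+|X¹-X²|²/κ)` with noise (maximal function in `L²`, measure
preservation, Itô correction `≤ 4` per unit time). -/
def LogSplittingCost : Prop :=
  ∀ h : 𝕋² → ℝ, Torus.IsSmooth h →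
    ∃ C : ℝ, 0 ≤ C ∧
      ∀ (κ : ℝ) (u : ℝ → 𝕋² → E²) (θ : ℝ → 𝕋² → ℝ),
        0 < κ → κ ≤ 1 / 2 →
        IsClassicalScalarTransportForcedOn (Set.Ioi 0) κ u (fun _ => h) θ →
        ∀ (t₀ T ℓ : ℝ), 0 < t₀ → 0 < T → 0 < ℓ →
          scalarDissipation κ θ t₀ (t₀ + T) ≤
            C * (scalarL2Sq (θ t₀) + ℓ ^ 2 * T ^ 2
              + T ^ 2 * ((∫ s in t₀..(t₀ + T), Real.sqrt (Torus.gradNormSq (u s))) + T + 1)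
                / Real.log (1 + ℓ ^ 2 / κ))

/-- **Conditional 2-D core implied by `LogSplittingCost` (card `replica-log-cost-enstrophy-threshold`).**
Steady smooth planar force `g` and source `h`; `ν_j → 0`; 2-D global Leray–Hopf `v_j` (force `g`);
sourced scalars `θ_j` (Prandtl number one) with limsup-mean `‖θ_j‖²` bounded; IF the limsup-mean
planar enstrophy `Z_j` satisfies `Z_j / log²(1/ν_j) → 0` THEN the limsup-mean scalar dissipation
`ν_j‖∇θ_j‖²` tends to `0`. (Single-shell / first-shell planar forces have `Z_j` bounded — the known
sub-cases; Kraichnan's log-corrected cascade predicts `Z_j ~ log^{2/3}`.) -/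
def ScalarNoAnomalyBelowLogSqEnstrophy : Prop :=
  ∀ (g : 𝕋² → E²) (h : 𝕋² → ℝ), Torus.IsSmooth g → Torus.IsDivFree g → Torus.HasZeroMean g →
    Torus.IsSmooth h → Torus.HasZeroMean h →
    ∀ (ν : ℕ → ℝ) (v₀ : ℕ → 𝕋² → E²) (v : ℕ → ℝ → 𝕋² → E²) (θ₀ : ℕ → 𝕋² → ℝ)
      (θ : ℕ → ℝ → 𝕋² → ℝ) (Z : ℕ → ℝ),
      (∀ j, 0 < ν j) → Tendsto ν atTop (nhds 0) →
      (∀ j, IsGlobalLerayHopf (ν j) (fun _ => g) (v₀ j) (v j)) →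
      (∀ j, MemLp (θ₀ j) 2 volume) →
      (∀ j, IsWeakScalarTransportForced (ν j) (v j) (fun _ => h) (θ₀ j) (θ j)) →
      (∃ E : ℝ, ∀ j, meanEnergy (v j) ≤ E) →
      (∃ E : ℝ, ∀ j, longTimeAvgSup (fun t => scalarL2Sq (θ j t)) ≤ E) →
      (∀ j, longTimeAvgSup (fun t => (Torus.eGradNormSq (v j t)).toReal) ≤ Z j) →
      Tendsto (fun j => Z j / Real.log (1 / ν j) ^ 2) atTop (nhds 0) →
      Tendsto (fun j => longTimeAvgSup (fun t => ν j * (eScalarGradNormSq (θ j t)).toReal))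
        atTop (nhds 0)

/-- **Support P1 of card `replica-log-cost-enstrophy-threshold` (near-invariance of a sourced scalar under
the free evolution; applied to the planar vorticity).** Let `φ` be a classical solution of
`∂ₜφ + u·∇φ = κΔφ + q` (smooth steady source `q`; for the vorticity `q = curl g`) and let `ψ` be the
classical solution of the FREE equation `∂ₜψ + u·∇ψ = κΔψ` on `[t₀, ∞)` started from the current
field, `ψ(t₀) = φ(t₀)`. Then for every `T > 0`
`‖φ(t₀)‖² - ‖ψ(t₀+T)‖² ≤ 4·κ∫_{t₀}^{t₀+T}‖∇φ‖² + 4·T²·sup q²`: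
the loss is controlled by the THROUGHPUT of `φ`, not by `‖φ(t₀)‖²` (Lagrangian reading:
`∫E|φ(X¹_{t₀}) - φ(X²_{t₀})|² = 2(‖φ(t₀)‖² - ‖ψ(t₀+T)‖²)` for two replicas from a common point —
replica pairs never straddle `φ`-levels further apart than `O(√T + T)`). -/
def SourcedScalarNearInvariance : Prop :=
  ∀ (q : 𝕋² → ℝ), Torus.IsSmooth q →
    ∃ Cq : ℝ, 0 ≤ Cq ∧
      ∀ (κ : ℝ) (u : ℝ → 𝕋² → E²) (φ ψ : ℝ → 𝕋² → ℝ) (t₀ T : ℝ),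
        0 < κ → 0 < t₀ → 0 < T →
        IsClassicalScalarTransportForcedOn (Set.Ioi 0) κ u (fun _ => q) φ →
        IsClassicalScalarTransportOn (Set.Ici t₀) κ u ψ → ψ t₀ = φ t₀ →
        scalarL2Sq (φ t₀) - scalarL2Sq (ψ (t₀ + T)) ≤
          4 * scalarDissipation κ φ t₀ (t₀ + T) + 4 * T ^ 2 * Cq

/-- **High-enstrophy branch (K1 of card `replica-log-cost-enstrophy-threshold`), the honest complement of
`ScalarNoAnomalyBelowLogSqEnstrophy`.** Same data; IF the limsup-mean planar enstrophy is at least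
`c · log²(1/ν_j)` for some `c > 0` THEN the limsup-mean scalar dissipation still tends to `0`. Together with the
sub-log² branch (subsequence dichotomy on `Z_j / log²(1/ν_j)`), the velocity half (Alexakis–Doering) and the
`twoHalf` bookkeeping this yields `TwohalfdNeg`. Open; the card's K1b names the intended mechanism (frozen enstrophy
at bounded throughput does not split replica pairs). -/
def ScalarNoAnomalyHighEnstrophyBranch : Prop :=
  ∀ (g : 𝕋² → E²) (h : 𝕋² → ℝ), Torus.IsSmooth g → Torus.IsDivFree g → Torus.HasZeroMean g →
    Torus.IsSmooth h → Torus.HasZeroMean h →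
    ∀ (ν : ℕ → ℝ) (v₀ : ℕ → 𝕋² → E²) (v : ℕ → ℝ → 𝕋² → E²) (θ₀ : ℕ → 𝕋² → ℝ)
      (θ : ℕ → ℝ → 𝕋² → ℝ) (c : ℝ),
      (∀ j, 0 < ν j) → Tendsto ν atTop (nhds 0) → 0 < c →
      (∀ j, IsGlobalLerayHopf (ν j) (fun _ => g) (v₀ j) (v j)) →
      (∀ j, MemLp (θ₀ j) 2 volume) →
      (∀ j, IsWeakScalarTransportForced (ν j) (v j) (fun _ => h) (θ₀ j) (θ j)) →
      (∃ E : ℝ, ∀ j, meanEnergy (v j) ≤ E) →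
      (∃ E : ℝ, ∀ j, longTimeAvgSup (fun t => scalarL2Sq (θ j t)) ≤ E) →
      (∀ j, c * Real.log (1 / ν j) ^ 2 ≤ longTimeAvgSup (fun t => (Torus.eGradNormSq (v j t)).toReal)) →
      Tendsto (fun j => longTimeAvgSup (fun t => ν j * (eScalarGradNormSq (θ j t)).toReal))
        atTop (nhds 0)


/-! ### Card 2 — `streamline-solvability-steady-branch` -/

/-- **First lemma of card `streamline-solvability-steady-branch` (the solvability-defect identity).**
Steady 2-D stirring with a first integral: `V` smooth divergence free, `ψ` smooth with `V·∇ψ = 0`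
(e.g. the stream function of a mean-zero `V`), `W` a smooth steady solution of `V·∇W = νΔW + h`. Then for
every `C¹` function `F` of one variable,
`∫ h·F(ψ) = ν ∫ F′(ψ) ∇ψ·∇W` :
the source is orthogonal to every function of the stream function up to `√(ν·D)·‖∇(F∘ψ)‖`
(`D = ν‖∇W‖²` the scalar dissipation). Proof: multiply the equation by `F(ψ)`, integrate, use
`∫ F(ψ) V·∇W = -∫ W V·∇(F∘ψ) = 0` and integrate `ν∫F(ψ)ΔW` by parts. -/
def SteadySolvabilityDefect : Prop :=
  ∀ (ν : ℝ) (V : 𝕋² → E²) (ψ W h : 𝕋² → ℝ) (F : ℝ → ℝ),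
    Torus.IsSmooth V → Torus.IsDivFree V → Torus.IsSmooth ψ → Torus.IsSmooth W → Torus.IsSmooth h →
    ContDiff ℝ 1 F →
    (∀ x, inner ℝ (V x) (Torus.gradient ψ x) = 0) →
    (∀ x, inner ℝ (V x) (Torus.gradient W x) = ν * Torus.laplacian W x + h x) →
    ∫ x, h x * F (ψ x) = ν * ∫ x, deriv F (ψ x) * inner ℝ (Torus.gradient ψ x) (Torus.gradient W x)

/-- **Companion identity (orbit coboundary pairing).** Same steady setting; for every smooth `Φ`,
`∫ (V·∇Φ)·W = ν ∫ ∇Φ·∇W - ∫ Φ·h` (test the steady equation against `Φ`). With `Φ` an (approximate)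
orbit potential of `h - E[h|ψ]` normalised to zero orbit means, `∫Φ h = 0` and the left side is the
"along-streamline" part of the input `∫ h W`. -/
def SteadyCoboundaryPairing : Prop :=
  ∀ (ν : ℝ) (V : 𝕋² → E²) (W h Φ : 𝕋² → ℝ),
    Torus.IsSmooth V → Torus.IsDivFree V → Torus.IsSmooth W → Torus.IsSmooth h → Torus.IsSmooth Φ →
    (∀ x, inner ℝ (V x) (Torus.gradient W x) = ν * Torus.laplacian W x + h x) →
    ∫ x, inner ℝ (V x) (Torus.gradient Φ x) * W x =
      ν * (∫ x, inner ℝ (Torus.gradient Φ x) (Torus.gradient W x)) - ∫ x, Φ x * h x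

/-- **The steady planar branch (2-D core of card `streamline-solvability-steady-branch`).** Steady smooth
force `g` and source `h`; `ν_j → 0`; mean-zero steady classical Navier–Stokes states `V_j` (force `g`,
pressure `p_j`) with bounded energy — ANY enstrophy — and steady classical scalars `W_j`,
`V_j·∇W_j = ν_jΔW_j + h`, with bounded variance. THEN the scalar dissipation `ν_j‖∇W_j‖²` tends to `0`.
(Long-time means of an x₃-invariant Leray–Hopf family whose planar part converges to `V_j` at fixed `j`
are these steady values; the first-shell sub-case E1SUBCASE is the Marchioro instance.) -/
def SteadyPlanarScalarNoAnomaly : Prop :=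
  ∀ (g : 𝕋² → E²) (h : 𝕋² → ℝ), Torus.IsSmooth g → Torus.IsDivFree g → Torus.HasZeroMean g →
    Torus.IsSmooth h → Torus.HasZeroMean h →
    ∀ (ν : ℕ → ℝ) (V : ℕ → 𝕋² → E²) (p W : ℕ → 𝕋² → ℝ),
      (∀ j, 0 < ν j) → Tendsto ν atTop (nhds 0) →
      (∀ j, Torus.IsClassicalNSSolutionOn Set.univ (ν j) (fun _ => g) (fun _ => V j) (fun _ => p j)) →
      (∀ j, Torus.HasZeroMean (V j)) →
      (∀ j, Torus.IsSmooth (W j) ∧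
        ∀ x, inner ℝ (V j x) (Torus.gradient (W j) x) = ν j * Torus.laplacian (W j) x + h x) →
      (∃ E : ℝ, ∀ j, ∫ x, ‖V j x‖ ^ 2 ≤ E) →
      (∃ E : ℝ, ∀ j, ∫ x, (W j x) ^ 2 ≤ E) →
      Tendsto (fun j => ν j * scalarGradNormSq (W j)) atTop (nhds 0)

end Summit.AnomalousDissipation.AnomalousDissipation.Cruxes.TwohalfdNeg.Ideator1
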